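import Summits.BirchSwinnertonDyer.BirchSwinnertonDyer.Theorems.ByReductionTypeAtTwoAdditiveGammaTwistKernelConverse
import Summits.BirchSwinnertonDyer.BirchSwinnertonDyer.Theorems.ByReductionTypeAtTwoAdditiveKatoTransportPrintExactAnyImageDoors
import HarnessLib

/-!
# Route ByReductionTypeAtTwo, crux C4″ `AdditivePotMultOverKAtTwo` (stmt-BirchSwinnertonDyer-22618; parent
# `AdditiveRankZeroAtTwo` 19098) — R16, part 3: R15 IN THE KERNEL FOR ANY IMAGE of `ρ̄_{W,2}`:
# `KatoOddBranchInputsAtTwoNegOneSplitTwistPrintExactAnyImage ↔ KatoOddBranchInputsAtTwoNegTwoSplitTwistPrintExactAnyImage`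
# (GEN 2/3's transport re-run without the scope binder «`W[2]` irreducible»), and the `(−2)`-block doors — keys `γ⁻¹`
# and `γ` — keyed ENTIRELY by the ONE image-free `(−1)`-block input (theorems only)

Cell `bsd-2adic`, seat `bsd-2adic-k4-w3` GEN 4. GEN 3 (p696121/p696613) proved `KatoOddBranchInputsAtTwoNegOneSplitTwistPrintExact
↔ KatoOddBranchInputsAtTwoNegTwoSplitTwistPrintExact` for addL2x GEN 16's constants, whose scope binder `W.HasIrreducibleModPGaloisRep 2`
made R15 kernel for the two IRREDUCIBLE split-twist blocks only; for the two REDUCIBLE blocks (GEN 0's R14 targets) R15 stayed a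
READING. Nothing in the transport looks at the image: the POINTWISE package transports
`negTwoPackage_of_negOnePackage_of_twTransport` / `negOnePackage_of_negTwoPackage_of_twTransport` (GEN 2/3; Literature
`Kato2004.exists_multDivisibilityInputsContra_of_semilinear_sideConditions`, any ring automorphism `θ`), the avatars
`exists_neg{One,Two}Avatar_of_quadraticTwist_two` (every elliptic `W`), the `𝐇¹_Γ`-twin `exists_iwasawaH1Data_negTwist_two`
(layer isomorphisms from `T₂W ≅ T₂W₂ ⊗ χ₂` for ANY model, p694845) and t42 GEN 22's `X`-twin
`AddSelmerTwistTwo.exists_twist_selmerDualData_two_inv` are all image-free. This file assembles them against the image-free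
constants of `…AdditiveKatoTransportPrintExactAnyImageDefs.lean`:

* §1 `twTransport_of_negTwoSplitTwist_anyImage`, **`katoOddBranchInputsNegTwoPrintExactAnyImage_of_negOne`**;
* §2 `twTransport_of_negOneSplitTwist_anyImage`, `katoOddBranchInputsNegOnePrintExactAnyImage_of_negTwo`,
  **`katoOddBranchInputsNegOnePrintExactAnyImage_iff_negTwo`**; by-name corollary: the ONE image-free `(−1)` input implies BOTH
  addL2x GEN 16 constants (`katoOddBranchInputsAtTwoSplitTwistPrintExact_of_negOneAnyImage`);
* §3 the `(−2)`-block's doors (key `γ⁻¹` ideal/length form, key `γ`) RE-KEYED by `(−1)`-block data for ANY image: input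
  `KatoOddBranchInputsAtTwoNegOneSplitTwistPrintExactAnyImage` and an integral multiple `L̃ = 2^m·L⁻_2(f,1,ω)` of the UNTWISTED
  branch; conclusion `ℓ_𝔮(X) ≤ ℓ_𝔮(Λ/(Tw L̃))` at every height-one `𝔮 ∌ 2` (`Tw L̃` = the `ωχ₂`-branch multiple,
  `unitTwist_doorMultiple_of_split`; image-free twins of GEN 3's §2 doors, plus the key-`γ` one).

So, BY NAME, the four split-twist block targets of C4″ — `KatoSharpAtTwoAdditiveNeg{One,Two}SplitTwist` (irreducible; + (A))
and `KatoMemberSharpAtTwoAdditiveNeg{One,Two}SplitTwistReducible` (reducible; (A) PRINT there) — read through ONE constant,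
`KatoOddBranchInputsAtTwoNegOneSplitTwistPrintExactAnyImage` (R16). HONEST FRAMING (D-0036 / D-0054): theorems only — no
definition, no named fact, no instance, no `sorry`; route-independent (no `Theses` import); shrinks-literal (the reducible
blocks' transport READING ↦ KERNEL; four typed inputs ↦ one); closes none; nothing booked; BSD is not proved by any of this.
PARTITION: X5@2 additive potentially-multiplicative block, the four (−1)/(−2) × irreducible/reducible split-twist sub-blocks
× `p = 2`.

References: [GreenbergLNM1716] §4 p. 107; [Rubin2000] Ch. VI §1–§2; [Kato2004Asterisque] Thm. 12.4 (2) (p. 221), Thm. 12.5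
(3)(4) with (12.5.1)/(12.5.2) (p. 222), §17.13 (pp. 279–280); [SilvermanAEC2009] X.5 Cor. 5.4, VIII.8 Cor. 8.3;
[MazurTateTeitelbaum1986Invent] §I.13, §I.17; [Greenberg1989] pp. 101–102; memo
`run/shared/lean/pub/bsd-2adic/k4w3/gen4/VERDICT-22618-k4w3-GEN4.md`.
-/

set_option autoImplicit false
-- the summit's namespace `Summit.BirchSwinnertonDyer.BirchSwinnertonDyer` (Sub = Summit) trips `dupNamespace`
set_option linter.dupNamespace false

noncomputable section

open scoped MatrixGroups ModularForm

open Field CongruenceSubgroup WeierstrassCurve Literature.NumberTheory.EllipticCurves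
  Literature.NumberTheory.EllipticCurves.ModularForms Literature.NumberTheory.EllipticCurves.PadicIntSeries
  Literature.NumberTheory.GaloisRepresentations

namespace Summit.BirchSwinnertonDyer.BirchSwinnertonDyer.Theorems.AddKatoTwoGammaTwist

open Summit.BirchSwinnertonDyer.BirchSwinnertonDyer.Theorems.AddKatoTwo
open Summit.BirchSwinnertonDyer.BirchSwinnertonDyer.Theorems.AddSelmerTwistTwo (exists_twist_selmerDualData_two_inv)

/-! ## §1 `(−1) ⟹ (−2)` for any image -/

/-- **The `(−1)`-block avatar with the `Tw`-identifications of both Kato carriers, ANY image of `ρ̄_{W,2}`** — GEN 3's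
`twTransport_of_negTwoSplitTwist` without the binder/conjunct «`W[2]` irreducible». For `W` globally minimal with `W^{(−2)}`
split multiplicative at `2`, `(κ, γ)` cyclotomic, `f` a newform of `W^{(−2)}`: `W₂` := a globally minimal model of `W^{(2)}`
(`exists_negOneAvatar_of_quadraticTwist_two`), `W₂^{(−1)}` split multiplicative at `2`, `f` a newform of `W₂^{(−1)}`;
`𝐇¹_Γ`-twin by `exists_iwasawaH1Data_negTwist_two`; `X(·/ℚ_∞)`-twin keyed `γ⁻¹` by
`AddSelmerTwistTwo.exists_twist_selmerDualData_two_inv`. [cite: GreenbergLNM1716, §4 (p. 107)] [cite: Rubin2000, Ch. VI §1–§2]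
[cite: SilvermanAEC2009, X.5 Cor. 5.4, VIII.8 Cor. 8.3] -/
theorem twTransport_of_negTwoSplitTwist_anyImage (W : WeierstrassCurve ℚ) [W.IsElliptic] [W.IsGloballyMinimal]
    [ContinuousSMul ℤ_[2] (W.tateModule 2)]
    {N : ℕ} [NeZero N] (f : CuspForm (Gamma0 N) 2) (κ : ZpExtension ℚ 2) (γ : absoluteGaloisGroup ℚ)
    (hsp : (W.quadraticTwist (-2)).HasSplitMultiplicativeReductionAtPrime 2)
    (hκ : κ.IsCyclotomic) (hγ : κ.IsTopGenerator γ) (hf : IsNewformOf (W.quadraticTwist (-2)) f) :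
    ∃ (W₂ : WeierstrassCurve ℚ) (_ : W₂.IsElliptic) (_ : W₂.IsGloballyMinimal)
      (_ : ContinuousSMul ℤ_[2] (W₂.tateModule 2)),
      (W₂.quadraticTwist (-1)).HasSplitMultiplicativeReductionAtPrime 2 ∧
      IsNewformOf (W₂.quadraticTwist (-1)) f ∧
      ∀ (I : Kato2004.IwasawaH1Data W 2 κ γ) (D' : W.SelmerDualData κ γ⁻¹),
        ∃ (I₂ : Kato2004.IwasawaH1Data W₂ 2 κ γ) (D₂' : W₂.SelmerDualData κ γ⁻¹)
          (eI : I₂.H ≃+ I.H) (eD : D₂'.X ≃+ D'.X),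
          (∀ (r : IwasawaAlgebra 2) (h : I₂.H), eI (r • h) = unitTwist r (-1) • eI h) ∧
          (∀ (r : IwasawaAlgebra 2) (x : D₂'.X), eD (r • x) = unitTwist r (-1) • eD x) := by
  obtain ⟨W₂, hE₂, hmin₂, C, hC, hsp_iff, -, hnf⟩ := exists_negOneAvatar_of_quadraticTwist_two W
  letI : ContinuousSMul ℤ_[2] (W₂.tateModule 2) := TateModule.continuousSMul_padicInt
  refine ⟨W₂, hE₂, hmin₂, inferInstance, hsp_iff.mpr hsp, hnf f hf, fun I D' ↦ ?_⟩
  obtain ⟨I₂, eI, heI⟩ := exists_iwasawaH1Data_negTwist_two W W₂ C hC κ γ hκ hγ I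
  obtain ⟨D₂', eD, heD, -⟩ := exists_twist_selmerDualData_two_inv κ hκ W W₂ hC hγ D'
  exact ⟨I₂, D₂', eI, eD, heI, fun r x ↦ heD r x⟩

/-- **R15 is KERNEL for any image: `KatoOddBranchInputsAtTwoNegOneSplitTwistPrintExactAnyImage ⟹
KatoOddBranchInputsAtTwoNegTwoSplitTwistPrintExactAnyImage`** with no further hypothesis — GEN 2's pointwise package
transport `negTwoPackage_of_negOnePackage_of_twTransport` at the avatar of `twTransport_of_negTwoSplitTwist_anyImage`.
[cite: GreenbergLNM1716, §4 (p. 107)] [cite: Rubin2000, Ch. VI §1–§2]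
[cite: Kato2004Asterisque, Thm. 12.5 (3) with (12.5.1) (p. 222), §17.13 (pp. 279–280)] -/
theorem katoOddBranchInputsNegTwoPrintExactAnyImage_of_negOne
    (hPE : KatoOddBranchInputsAtTwoNegOneSplitTwistPrintExactAnyImage) :
    KatoOddBranchInputsAtTwoNegTwoSplitTwistPrintExactAnyImage := by
  intro W _ _ _ N _ f κ γ hsp hκ hγ hγ' hf I D'
  obtain ⟨W₂, _, _, _, hsp₂, hf₂, hcar⟩ := twTransport_of_negTwoSplitTwist_anyImage W f κ γ hsp hκ hγ hf
  exact negTwoPackage_of_negOnePackage_of_twTransport W W₂ f κ γ hsp hf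
    (fun I₂ D₂' ↦ hPE W₂ f κ γ hsp₂ hκ hγ hγ' hf₂ I₂ D₂') hcar I D'

/-! ## §2 `(−2) ⟹ (−1)` for any image, and the equivalence -/

/-- **The `(−2)`-block avatar of a `(−1)`-block curve with the `Tw`-identifications of both Kato carriers, ANY image** —
GEN 3's `twTransport_of_negOneSplitTwist` without «`W[2]` irreducible»: `W₂` := a globally minimal model of `W^{(2)}`
(`exists_negTwoAvatar_of_quadraticTwist_two`: `W₂^{(−2)} ≅_ℚ W^{(−1)}`), the two twins as in §1.
[cite: GreenbergLNM1716, §4 (p. 107)] [cite: Rubin2000, Ch. VI §1–§2] [cite: SilvermanAEC2009, X.5 Cor. 5.4, VIII.8 Cor. 8.3] -/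
theorem twTransport_of_negOneSplitTwist_anyImage (W : WeierstrassCurve ℚ) [W.IsElliptic] [W.IsGloballyMinimal]
    [ContinuousSMul ℤ_[2] (W.tateModule 2)]
    {N : ℕ} [NeZero N] (f : CuspForm (Gamma0 N) 2) (κ : ZpExtension ℚ 2) (γ : absoluteGaloisGroup ℚ)
    (hsp : (W.quadraticTwist (-1)).HasSplitMultiplicativeReductionAtPrime 2)
    (hκ : κ.IsCyclotomic) (hγ : κ.IsTopGenerator γ) (hf : IsNewformOf (W.quadraticTwist (-1)) f) :
    ∃ (W₂ : WeierstrassCurve ℚ) (_ : W₂.IsElliptic) (_ : W₂.IsGloballyMinimal)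
      (_ : ContinuousSMul ℤ_[2] (W₂.tateModule 2)),
      (W₂.quadraticTwist (-2)).HasSplitMultiplicativeReductionAtPrime 2 ∧
      IsNewformOf (W₂.quadraticTwist (-2)) f ∧
      ∀ (I : Kato2004.IwasawaH1Data W 2 κ γ) (D' : W.SelmerDualData κ γ⁻¹),
        ∃ (I₂ : Kato2004.IwasawaH1Data W₂ 2 κ γ) (D₂' : W₂.SelmerDualData κ γ⁻¹)
          (eI : I₂.H ≃+ I.H) (eD : D₂'.X ≃+ D'.X),
          (∀ (r : IwasawaAlgebra 2) (h : I₂.H), eI (r • h) = unitTwist r (-1) • eI h) ∧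
          (∀ (r : IwasawaAlgebra 2) (x : D₂'.X), eD (r • x) = unitTwist r (-1) • eD x) := by
  obtain ⟨W₂, hE₂, hmin₂, C, hC, hsp_iff, -, hnf⟩ := exists_negTwoAvatar_of_quadraticTwist_two W
  letI : ContinuousSMul ℤ_[2] (W₂.tateModule 2) := TateModule.continuousSMul_padicInt
  refine ⟨W₂, hE₂, hmin₂, inferInstance, hsp_iff.mpr hsp, hnf f hf, fun I D' ↦ ?_⟩
  obtain ⟨I₂, eI, heI⟩ := exists_iwasawaH1Data_negTwist_two W W₂ C hC κ γ hκ hγ I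
  obtain ⟨D₂', eD, heD, -⟩ := exists_twist_selmerDualData_two_inv κ hκ W W₂ hC hγ D'
  exact ⟨I₂, D₂', eI, eD, heI, fun r x ↦ heD r x⟩

/-- **The converse for any image: `KatoOddBranchInputsAtTwoNegTwoSplitTwistPrintExactAnyImage ⟹
KatoOddBranchInputsAtTwoNegOneSplitTwistPrintExactAnyImage`** (GEN 3's `negOnePackage_of_negTwoPackage_of_twTransport` at the
avatar of `twTransport_of_negOneSplitTwist_anyImage`). [cite: GreenbergLNM1716, §4 (p. 107)] [cite: Rubin2000, Ch. VI §1–§2]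
[cite: Kato2004Asterisque, Thm. 12.5 (3) with (12.5.1) (p. 222), §17.13 (pp. 279–280)] -/
theorem katoOddBranchInputsNegOnePrintExactAnyImage_of_negTwo
    (hPE : KatoOddBranchInputsAtTwoNegTwoSplitTwistPrintExactAnyImage) :
    KatoOddBranchInputsAtTwoNegOneSplitTwistPrintExactAnyImage := by
  intro W _ _ _ N _ f κ γ hsp hκ hγ hγ' hf I D'
  obtain ⟨W₂, _, _, _, hsp₂, hf₂, hcar⟩ := twTransport_of_negOneSplitTwist_anyImage W f κ γ hsp hκ hγ hf
  exact negOnePackage_of_negTwoPackage_of_twTransport W W₂ f κ γ hsp hf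
    (fun I₂ D₂' ↦ hPE W₂ f κ γ hsp₂ hκ hγ hγ' hf₂ I₂ D₂') hcar I D'

/-- **The two image-free print-exact odd-branch packages of C4″'s split-twist blocks are ONE object:**
`KatoOddBranchInputsAtTwoNegOneSplitTwistPrintExactAnyImage ↔ KatoOddBranchInputsAtTwoNegTwoSplitTwistPrintExactAnyImage`
(R15 kernel in both directions, any image of `ρ̄_{W,2}` — the reducible blocks included).
[cite: GreenbergLNM1716, §4 (p. 107)] [cite: Rubin2000, Ch. VI §1–§2]
[cite: Kato2004Asterisque, Thm. 12.5 (3)(4) with (12.5.1)/(12.5.2) (p. 222), §17.13 (pp. 279–280)] -/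
theorem katoOddBranchInputsNegOnePrintExactAnyImage_iff_negTwo :
    KatoOddBranchInputsAtTwoNegOneSplitTwistPrintExactAnyImage ↔
      KatoOddBranchInputsAtTwoNegTwoSplitTwistPrintExactAnyImage :=
  ⟨katoOddBranchInputsNegTwoPrintExactAnyImage_of_negOne, katoOddBranchInputsNegOnePrintExactAnyImage_of_negTwo⟩

/-- **By name: the ONE image-free `(−1)` input implies BOTH addL2x GEN 16 block inputs** (`KatoOddBranchInputsAtTwoNegOneSplitTwistPrintExact`,
p683821, and `KatoOddBranchInputsAtTwoNegTwoSplitTwistPrintExact`, p684511 — the names the irreducible blocks' board word cites).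
[cite: Kato2004Asterisque, Thm. 12.5 (3)(4) with (12.5.1)/(12.5.2) (p. 222), §17.13 (pp. 279–280)] [cite: GreenbergLNM1716, §4 (p. 107)] -/
theorem katoOddBranchInputsAtTwoSplitTwistPrintExact_of_negOneAnyImage
    (hPE : KatoOddBranchInputsAtTwoNegOneSplitTwistPrintExactAnyImage) :
    KatoOddBranchInputsAtTwoNegOneSplitTwistPrintExact ∧ KatoOddBranchInputsAtTwoNegTwoSplitTwistPrintExact :=
  ⟨katoOddBranchInputsAtTwoNegOneSplitTwistPrintExact_of_anyImage hPE,
    katoOddBranchInputsAtTwoNegTwoSplitTwistPrintExact_of_anyImage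
      (katoOddBranchInputsNegTwoPrintExactAnyImage_of_negOne hPE)⟩

/-! ## §3 The `(−2)`-block's doors keyed ENTIRELY by the ONE image-free `(−1)`-block input -/

/-- **Key-`γ⁻¹` door of the `(−2)`-block, ANY image, keyed by `(−1)`-block data.** For `W` globally minimal, additive with
`W^{(−2)}` split multiplicative at `2`, `f` the newform of `W^{(−2)}`, `(κ, γ)` cyclotomic, `D'` the key-`γ⁻¹` dual Selmer
datum with `D'.X` finitely generated and `ι(char D'.X) = char D'.X`, and `L̃ ∈ Λ`, `L̃ ≠ 0`, with `L̃^ℚ = 2^m·L⁻_2(f,1,ω)` (the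
UNTWISTED one-term minus branch): `ℓ_𝔮(D'.X) ≤ ℓ_𝔮(Λ/(Tw L̃))` at every height-one `𝔮 ∌ 2`, GIVEN `Kato2004.thm12_4` and the
image-free `(−1)`-block input — by `AddKatoTwo.lengthAt_selmerDualContra_le_of_oddBranchInputsNegTwoPrintExactAnyImage_fe` with
its input supplied by `katoOddBranchInputsNegTwoPrintExactAnyImage_of_negOne` and `(L̃, m)` transported by
`unitTwist_doorMultiple_of_split` (`(Tw L̃)^ℚ = 2^m·L⁻_2(f,1,ωχ₂)`, `Tw L̃ ≠ 0`). Image-free twin of GEN 3's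
`lengthAt_selmerDualContra_le_of_oddBranchInputsNegOnePrintExact_fe`.
[cite: Kato2004Asterisque, Thm. 12.4 (2) (p. 221), Thm. 12.5 (3) and (12.5.1) (p. 222), §17.13 (pp. 279–280)]
[cite: GreenbergLNM1716, §4 (p. 107)] [cite: MazurTateTeitelbaum1986Invent, §I.17] -/
theorem lengthAt_selmerDualContra_le_of_oddBranchInputsNegOnePrintExactAnyImage_fe (h12 : Kato2004.thm12_4)
    (hPE : KatoOddBranchInputsAtTwoNegOneSplitTwistPrintExactAnyImage)
    (W : WeierstrassCurve ℚ) [W.IsElliptic] [W.IsGloballyMinimal] [ContinuousSMul ℤ_[2] (W.tateModule 2)]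
    {N : ℕ} [NeZero N] (f : CuspForm (Gamma0 N) 2) (κ : ZpExtension ℚ 2) (γ : absoluteGaloisGroup ℚ)
    (hsp : (W.quadraticTwist (-2)).HasSplitMultiplicativeReductionAtPrime 2)
    (hκ : κ.IsCyclotomic) (hγ : κ.IsTopGenerator γ)
    (hγ' : IsCyclotomicVariable 2 γ) (hf : IsNewformOf (W.quadraticTwist (-2)) f)
    (I : Kato2004.IwasawaH1Data W 2 κ γ) (D' : W.SelmerDualData κ γ⁻¹) [Module.Finite (IwasawaAlgebra 2) D'.X]
    (hXι : (Module.charIdeal (IwasawaAlgebra 2) D'.X).map (IwasawaAlgebra.invol 2).toRingHom =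
      Module.charIdeal (IwasawaAlgebra 2) D'.X)
    (Lt : IwasawaAlgebra 2) (m : ℕ)
    (hLt : iwasawaToPowerSeries 2 Lt = PowerSeries.C ((2 : ℚ_[2]) ^ m) * padicLFunctionMinusBranchMult f (1 : ℚ_[2]) 1)
    (hLt0 : Lt ≠ 0)
    (𝔮 : PrimeSpectrum (IwasawaAlgebra 2)) (h𝔮 : 𝔮.asIdeal.height = 1)
    (hp𝔮 : PowerSeries.C (2 : ℤ_[2]) ∉ 𝔮.asIdeal) :
    Module.lengthAt (IwasawaAlgebra 2) D'.X 𝔮 ≤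
      Module.lengthAt (IwasawaAlgebra 2) (IwasawaAlgebra 2 ⧸ Ideal.span {unitTwist Lt (-1)}) 𝔮 :=
  lengthAt_selmerDualContra_le_of_oddBranchInputsNegTwoPrintExactAnyImage_fe h12
    (katoOddBranchInputsNegTwoPrintExactAnyImage_of_negOne hPE) W f κ γ hsp hκ hγ hγ' hf I D' hXι (unitTwist Lt (-1)) m
    (unitTwist_doorMultiple_of_split hsp hf hLt).1 ((unitTwist_doorMultiple_of_split hsp hf hLt).2.mpr hLt0) 𝔮 h𝔮 hp𝔮

/-- **Key-`γ⁻¹` door of the `(−2)`-block, LENGTH form, ANY image, keyed by `(−1)`-block data**: as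
`lengthAt_selmerDualContra_le_of_oddBranchInputsNegOnePrintExactAnyImage_fe` with the symmetry hypothesis in length form
`ℓ_𝔮(D'.X) = ℓ_{ι𝔮}(D'.X)` (finite generation of `D'.X` not needed). Image-free twin of GEN 3's
`lengthAt_selmerDualContra_le_of_oddBranchInputsNegOnePrintExact_of_lengthAt_symm_fe`.
[cite: Kato2004Asterisque, Thm. 12.5 (3) and (12.5.1) (p. 222), §17.13 (pp. 279–280)] [cite: GreenbergLNM1716, §4 (p. 107)]
[cite: MazurTateTeitelbaum1986Invent, §I.17] -/
theorem lengthAt_selmerDualContra_le_of_oddBranchInputsNegOnePrintExactAnyImage_of_lengthAt_symm_fe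
    (h12 : Kato2004.thm12_4) (hPE : KatoOddBranchInputsAtTwoNegOneSplitTwistPrintExactAnyImage)
    (W : WeierstrassCurve ℚ) [W.IsElliptic] [W.IsGloballyMinimal] [ContinuousSMul ℤ_[2] (W.tateModule 2)]
    {N : ℕ} [NeZero N] (f : CuspForm (Gamma0 N) 2) (κ : ZpExtension ℚ 2) (γ : absoluteGaloisGroup ℚ)
    (hsp : (W.quadraticTwist (-2)).HasSplitMultiplicativeReductionAtPrime 2)
    (hκ : κ.IsCyclotomic) (hγ : κ.IsTopGenerator γ)
    (hγ' : IsCyclotomicVariable 2 γ) (hf : IsNewformOf (W.quadraticTwist (-2)) f)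
    (I : Kato2004.IwasawaH1Data W 2 κ γ) (D' : W.SelmerDualData κ γ⁻¹)
    (Lt : IwasawaAlgebra 2) (m : ℕ)
    (hLt : iwasawaToPowerSeries 2 Lt = PowerSeries.C ((2 : ℚ_[2]) ^ m) * padicLFunctionMinusBranchMult f (1 : ℚ_[2]) 1)
    (hLt0 : Lt ≠ 0)
    (𝔮 : PrimeSpectrum (IwasawaAlgebra 2)) (h𝔮 : 𝔮.asIdeal.height = 1)
    (hp𝔮 : PowerSeries.C (2 : ℤ_[2]) ∉ 𝔮.asIdeal)
    (hXsym : Module.lengthAt (IwasawaAlgebra 2) D'.X 𝔮 =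
      Module.lengthAt (IwasawaAlgebra 2) D'.X (PrimeSpectrum.comap (IwasawaAlgebra.invol 2).toRingHom 𝔮)) :
    Module.lengthAt (IwasawaAlgebra 2) D'.X 𝔮 ≤
      Module.lengthAt (IwasawaAlgebra 2) (IwasawaAlgebra 2 ⧸ Ideal.span {unitTwist Lt (-1)}) 𝔮 :=
  lengthAt_selmerDualContra_le_of_oddBranchInputsNegTwoPrintExactAnyImage_of_lengthAt_symm_fe h12
    (katoOddBranchInputsNegTwoPrintExactAnyImage_of_negOne hPE) W f κ γ hsp hκ hγ hγ' hf I D' (unitTwist Lt (-1)) m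
    (unitTwist_doorMultiple_of_split hsp hf hLt).1 ((unitTwist_doorMultiple_of_split hsp hf hLt).2.mpr hLt0) 𝔮 h𝔮 hp𝔮
    hXsym

/-- **Key-`γ` door of the `(−2)`-block, ANY image, keyed by `(−1)`-block data** (the tree's dual Selmer datum `D` of key `γ`):
`ℓ_𝔮(D.X) ≤ ℓ_𝔮(Λ/(Tw L̃))` at every height-one `𝔮 ∌ 2`, from `Kato2004.thm12_4`, the image-free `(−1)`-block input,
`ι(char D.X) = char D.X` and an integral multiple `L̃ = 2^m·L⁻_2(f,1,ω) ≠ 0` of the untwisted branch — by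
`AddKatoTwo.lengthAt_selmerDual_le_of_oddBranchInputsNegTwoPrintExactAnyImage_fe` (this GEN), input and multiple transported as
above. [cite: Kato2004Asterisque, Thm. 12.4 (2) (p. 221), Thm. 12.5 (3) and (12.5.1) (p. 222), §17.3 (p. 273), §17.13 (pp. 279–280)]
[cite: Greenberg1989, pp. 101–102 (S^ι)] [cite: GreenbergLNM1716, §4 (p. 107)] [cite: MazurTateTeitelbaum1986Invent, §I.17] -/
theorem lengthAt_selmerDual_le_of_oddBranchInputsNegOnePrintExactAnyImage_fe (h12 : Kato2004.thm12_4)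
    (hPE : KatoOddBranchInputsAtTwoNegOneSplitTwistPrintExactAnyImage)
    (W : WeierstrassCurve ℚ) [W.IsElliptic] [W.IsGloballyMinimal] [ContinuousSMul ℤ_[2] (W.tateModule 2)]
    {N : ℕ} [NeZero N] (f : CuspForm (Gamma0 N) 2) (κ : ZpExtension ℚ 2) (γ : absoluteGaloisGroup ℚ)
    (hsp : (W.quadraticTwist (-2)).HasSplitMultiplicativeReductionAtPrime 2)
    (hκ : κ.IsCyclotomic) (hγ : κ.IsTopGenerator γ)
    (hγ' : IsCyclotomicVariable 2 γ) (hf : IsNewformOf (W.quadraticTwist (-2)) f)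
    (I : Kato2004.IwasawaH1Data W 2 κ γ) (D : W.SelmerDualData κ γ) [Module.Finite (IwasawaAlgebra 2) D.X]
    (hXι : (Module.charIdeal (IwasawaAlgebra 2) D.X).map (IwasawaAlgebra.invol 2).toRingHom =
      Module.charIdeal (IwasawaAlgebra 2) D.X)
    (Lt : IwasawaAlgebra 2) (m : ℕ)
    (hLt : iwasawaToPowerSeries 2 Lt = PowerSeries.C ((2 : ℚ_[2]) ^ m) * padicLFunctionMinusBranchMult f (1 : ℚ_[2]) 1)
    (hLt0 : Lt ≠ 0)
    (𝔮 : PrimeSpectrum (IwasawaAlgebra 2)) (h𝔮 : 𝔮.asIdeal.height = 1)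
    (hp𝔮 : PowerSeries.C (2 : ℤ_[2]) ∉ 𝔮.asIdeal) :
    Module.lengthAt (IwasawaAlgebra 2) D.X 𝔮 ≤
      Module.lengthAt (IwasawaAlgebra 2) (IwasawaAlgebra 2 ⧸ Ideal.span {unitTwist Lt (-1)}) 𝔮 :=
  lengthAt_selmerDual_le_of_oddBranchInputsNegTwoPrintExactAnyImage_fe h12
    (katoOddBranchInputsNegTwoPrintExactAnyImage_of_negOne hPE) W f κ γ hsp hκ hγ hγ' hf I D hXι (unitTwist Lt (-1)) m
    (unitTwist_doorMultiple_of_split hsp hf hLt).1 ((unitTwist_doorMultiple_of_split hsp hf hLt).2.mpr hLt0) 𝔮 h𝔮 hp𝔮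

end Summit.BirchSwinnertonDyer.BirchSwinnertonDyer.Theorems.AddKatoTwoGammaTwist

end
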